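import Literature.InformationTheory.Coding.SourcePolarizationStep
import Literature.InformationTheory.Entropy.MapEntropyChainRule
import HarnessLib

/-!
# One step of source polarization, I: counting and the conditional-entropy formula

Theorem-only companion of `Literature/InformationTheory/Coding/SourcePolarizationStep.lean`.
For a binary source with functional side information `g : ZMod 2 → Ω → β` (uniform `(B, W)`,
`Y = g B W`, fibre counts `N_b(y) = cnt g b y`, `M = |Ω|`):

* regrouping sums over the sample space by outputs (`sum_eq_sum_cnt`), the fibre sizes of `Y` and
  of `(B, Y)` (`card_fiber_out`, `card_fiber_pair`), invariance of `cnt`, `condEntG`, `bhatta`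
  under re-indexing `Ω` (`cnt_comp_equiv`, `condEntG_comp_equiv`, `bhatta_comp_equiv`);
* THE CONDITIONAL ENTROPY FORMULA `H(B | Y) = (2M)⁻¹ Σ_y pairEnt (N₀ y) (N₁ y)`
  (`condEntG_eq_sum_pairEnt`), i.e. `H(X|Y) = Σ_y P(y) h₂(P(X = 0 | y))`
  [Cover–Thomas, Thm 2.2.1];
* the Bhattacharyya parameter over any finite set of outputs containing the image
  (`bhatta_eq_sum`), and `0 ≤ Z ≤ 1` (`bhatta_nonneg`, `bhatta_le_one`, by AM–GM);
* `0 ≤ H(B|Y)` (`condEntG_nonneg`).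

The analytic bounds `Z² ≤ H ≤ log₂(1+Z)`, `H ≤ 1` and the one-step relations are in parts II–IV.

## References

* T. M. Cover, J. A. Thomas, *Elements of Information Theory*, 2nd ed., Wiley 2006, Thm 2.2.1.
* E. Arıkan, *Source polarization*, Proc. IEEE ISIT 2010, §II, eq. (2).  bib `Arikan2010`.
-/

noncomputable section

namespace Literature.InformationTheory.Coding.Polar

open Finset Literature.InformationTheory.Entropy

variable {Ω : Type*} [Fintype Ω] {β : Type*} [DecidableEq β]

/-! ### Counting -/

omit [DecidableEq β] in
/-- Membership in the set of outputs. [folklore] -/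
theorem mem_image_out_iff (g : ZMod 2 → Ω → β) [DecidableEq β] (y : β) :
    y ∈ univ.image (fun p : ZMod 2 × Ω => g p.1 p.2) ↔ ∃ b w, g b w = y := by
  simp only [mem_image, mem_univ, true_and, Prod.exists]

/-- Every output of `g` lies in its image. [folklore] -/
theorem mem_image_out (g : ZMod 2 → Ω → β) (b : ZMod 2) (w : Ω) :
    g b w ∈ univ.image (fun p : ZMod 2 × Ω => g p.1 p.2) :=
  (mem_image_out_iff g _).2 ⟨b, w, rfl⟩

/-- The counts of one input bit add up to `|Ω|` over any set of outputs containing them all.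
[folklore] -/
theorem sum_cnt (g : ZMod 2 → Ω → β) (b : ZMod 2) (T : Finset β) (hT : ∀ w, g b w ∈ T) :
    ∑ y ∈ T, cnt g b y = Fintype.card Ω := by
  unfold cnt
  rw [← Finset.card_univ, Finset.card_eq_sum_card_fiberwise (f := g b) (t := T) fun w _ => hT w]

/-- Real-valued form of `sum_cnt`. [folklore] -/
theorem sum_cnt_real (g : ZMod 2 → Ω → β) (b : ZMod 2) (T : Finset β) (hT : ∀ w, g b w ∈ T) :
    ∑ y ∈ T, (cnt g b y : ℝ) = Fintype.card Ω := by
  exact_mod_cast sum_cnt g b T hT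

/-- An output that does not occur has count `0`. [folklore] -/
theorem cnt_eq_zero_of_not_mem (g : ZMod 2 → Ω → β) (b : ZMod 2) {y : β}
    (hy : y ∉ univ.image (fun p : ZMod 2 × Ω => g p.1 p.2)) : cnt g b y = 0 := by
  unfold cnt
  rw [Finset.card_eq_zero, Finset.filter_eq_empty_iff]
  intro w _ hw
  exact hy ((mem_image_out_iff g y).2 ⟨b, w, hw⟩)

/-- A count is positive at an output that occurs with that input bit. [folklore] -/
theorem cnt_pos (g : ZMod 2 → Ω → β) (b : ZMod 2) (w : Ω) : 0 < cnt g b (g b w) :=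
  Finset.card_pos.2 ⟨w, by simp⟩

/-- **Regrouping by outputs**: a sum over the sample space of a function of `(B, Y)` is the sum over
outputs `y` and bits `b` weighted by the counts `N_b(y)`. [folklore] -/
theorem sum_eq_sum_cnt (g : ZMod 2 → Ω → β) (T : Finset β) (hT : ∀ b w, g b w ∈ T)
    (F : ZMod 2 → β → ℝ) :
    ∑ p : ZMod 2 × Ω, F p.1 (g p.1 p.2) = ∑ y ∈ T, ∑ b : ZMod 2, (cnt g b y : ℝ) * F b y := by
  rw [Fintype.sum_prod_type (fun p : ZMod 2 × Ω => F p.1 (g p.1 p.2)),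
    Finset.sum_comm (s := T) (t := (univ : Finset (ZMod 2)))]
  refine Finset.sum_congr rfl fun b _ => ?_
  rw [← Finset.sum_fiberwise_of_maps_to' (s := univ) (t := T) (g := g b) (fun w _ => hT b w)
    fun y => F b y]
  refine Finset.sum_congr rfl fun y _ => ?_
  rw [Finset.sum_const, nsmul_eq_mul]
  rfl

/-- Sums over `ZMod 2`. [folklore] -/
theorem sum_zmod_two {M : Type*} [AddCommMonoid M] (f : ZMod 2 → M) : ∑ b, f b = f 0 + f 1 :=
  Fin.sum_univ_two f

/-- The fibre of `(B, Y)` through `(b, w)` has `N_b(g b w)` elements. [folklore] -/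
theorem card_fiber_pair (g : ZMod 2 → Ω → β) (p : ZMod 2 × Ω) :
    (fiber univ (fun q : ZMod 2 × Ω => (q.1, g q.1 q.2)) (p.1, g p.1 p.2)).card =
      cnt g p.1 (g p.1 p.2) := by
  have h := card_fiber_prod_reveal (univ : Finset (ZMod 2)) (univ : Finset Ω) g (a := p.1)
    (b := p.2) (mem_univ _)
  rw [univ_product_univ] at h
  rw [h]
  rfl

/-- The fibre of `Y` over `y` has `N₀(y) + N₁(y)` elements. [folklore] -/
theorem card_fiber_out (g : ZMod 2 → Ω → β) (y : β) :
    (fiber univ (fun q : ZMod 2 × Ω => g q.1 q.2) y).card = ∑ b : ZMod 2, cnt g b y := by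
  unfold fiber cnt
  rw [Finset.card_filter,
    Fintype.sum_prod_type (fun q : ZMod 2 × Ω => if g q.1 q.2 = y then 1 else 0)]
  refine Finset.sum_congr rfl fun b _ => ?_
  rw [Finset.card_filter]

/-! ### Re-indexing the randomness -/

/-- Counts are invariant under re-indexing `Ω`. [folklore] -/
theorem cnt_comp_equiv {Ω' : Type*} [Fintype Ω'] (g : ZMod 2 → Ω → β) (e : Ω' ≃ Ω) (b : ZMod 2)
    (y : β) : cnt (fun b w => g b (e w)) b y = cnt g b y := by
  unfold cnt
  refine Finset.card_bij (fun w _ => e w) (fun w hw => by simpa using hw)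
    (fun _ _ _ _ h => e.injective h) fun w hw => ⟨e.symm w, by simpa using hw, e.apply_symm_apply w⟩

/-- The set of outputs is invariant under re-indexing `Ω`. [folklore] -/
theorem image_out_comp_equiv {Ω' : Type*} [Fintype Ω'] (g : ZMod 2 → Ω → β) (e : Ω' ≃ Ω) :
    univ.image (fun p : ZMod 2 × Ω' => g p.1 (e p.2)) =
      univ.image (fun p : ZMod 2 × Ω => g p.1 p.2) := by
  ext y
  rw [mem_image_out_iff (fun b w => g b (e w)), mem_image_out_iff g]
  constructor
  · rintro ⟨b, w, h⟩
    exact ⟨b, e w, h⟩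
  · rintro ⟨b, w, h⟩
    exact ⟨b, e.symm w, by simpa using h⟩

/-- The Bhattacharyya parameter is invariant under re-indexing `Ω`. [folklore] -/
theorem bhatta_comp_equiv {Ω' : Type*} [Fintype Ω'] (g : ZMod 2 → Ω → β) (e : Ω' ≃ Ω) :
    bhatta (fun b w => g b (e w)) = bhatta g := by
  unfold bhatta
  rw [image_out_comp_equiv g e, Fintype.card_congr e]
  simp only [cnt_comp_equiv]

/-- The conditional entropy is invariant under re-indexing `Ω`. [folklore] -/
theorem condEntG_comp_equiv {Ω' : Type*} [Fintype Ω'] (g : ZMod 2 → Ω → β) (e : Ω' ≃ Ω) :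
    condEntG (fun b w => g b (e w)) = condEntG g := by
  unfold condEntG
  rw [← mapEntropy_univ_comp_equiv (Equiv.prodCongr (Equiv.refl (ZMod 2)) e)
      (fun p : ZMod 2 × Ω => (p.1, g p.1 p.2)),
    ← mapEntropy_univ_comp_equiv (Equiv.prodCongr (Equiv.refl (ZMod 2)) e)
      (fun p : ZMod 2 × Ω => g p.1 p.2)]
  rfl

/-- `Src.minus` has the conditional entropy of `gMinus`. [folklore] -/
theorem Src.H_minus (S : Src) : S.minus.H = condEntG (gMinus S.g) := by
  rw [Src.H_def, condEnt_eq_condEntG, Src.minus_g]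
  exact condEntG_comp_equiv (gMinus S.g) (unpack S.m)

/-- `Src.plus` has the conditional entropy of `gPlus`. [folklore] -/
theorem Src.H_plus (S : Src) : S.plus.H = condEntG (gPlus S.g) := by
  rw [Src.H_def, condEnt_eq_condEntG, Src.plus_g]
  exact condEntG_comp_equiv (gPlus S.g) (unpack S.m)

/-- `Src.minus` has the Bhattacharyya parameter of `gMinus`. [folklore] -/
theorem Src.zParam_minus (S : Src) : S.minus.zParam = bhatta (gMinus S.g) := by
  rw [Src.zParam_def, Src.minus_g]
  exact bhatta_comp_equiv (gMinus S.g) (unpack S.m)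

/-- `Src.plus` has the Bhattacharyya parameter of `gPlus`. [folklore] -/
theorem Src.zParam_plus (S : Src) : S.plus.zParam = bhatta (gPlus S.g) := by
  rw [Src.zParam_def, Src.plus_g]
  exact bhatta_comp_equiv (gPlus S.g) (unpack S.m)

/-! ### The conditional entropy formula -/

/-- The sample space `ZMod 2 × Ω` has `2|Ω|` points. [folklore] -/
theorem card_sample (Ω : Type*) [Fintype Ω] :
    ((univ : Finset (ZMod 2 × Ω)).card : ℝ) = 2 * Fintype.card Ω := by
  rw [Finset.card_univ, Fintype.card_prod, ZMod.card]
  push_cast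
  ring

/-- **Conditional entropy formula**: `H(B | Y) = (2|Ω|)⁻¹ Σ_y pairEnt (N₀ y) (N₁ y)
= Σ_y P(y) h₂(P(B = 0 | Y = y))`, the sum running over any finite set of outputs containing the
image (the surprise of `(b, y)` given `y` is `log₂ ((N₀ y + N₁ y) / N_b y)`; regroup by outputs).
[cite: CoverThomas2006, Thm 2.2.1 (H(X|Y) = Σ_y p(y) H(X | Y = y))] -/
theorem condEntG_eq_sum_pairEnt [Nonempty Ω] (g : ZMod 2 → Ω → β) (T : Finset β)
    (hT : ∀ b w, g b w ∈ T) :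
    condEntG g = (∑ y ∈ T, pairEnt (cnt g 0 y) (cnt g 1 y)) / (2 * Fintype.card Ω) := by
  have hM : (0 : ℝ) < 2 * Fintype.card Ω := by
    have : 0 < Fintype.card Ω := Fintype.card_pos
    positivity
  unfold condEntG mapEntropy
  rw [card_sample, ← sub_div, ← Finset.sum_sub_distrib]
  congr 1
  have hterm : ∀ p : ZMod 2 × Ω,
      Real.logb 2 (2 * Fintype.card Ω /
          (fiber univ (fun q : ZMod 2 × Ω => (q.1, g q.1 q.2)) (p.1, g p.1 p.2)).card) -
        Real.logb 2 (2 * Fintype.card Ω /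
          (fiber univ (fun q : ZMod 2 × Ω => g q.1 q.2) (g p.1 p.2)).card) =
      Real.logb 2 ((∑ b, (cnt g b (g p.1 p.2) : ℝ)) / cnt g p.1 (g p.1 p.2)) := by
    intro p
    rw [card_fiber_pair, card_fiber_out]
    push_cast
    have h1 : (0 : ℝ) < cnt g p.1 (g p.1 p.2) := by exact_mod_cast cnt_pos g p.1 p.2
    have h2 : (0 : ℝ) < ∑ b, (cnt g b (g p.1 p.2) : ℝ) :=
      lt_of_lt_of_le h1 (Finset.single_le_sum (f := fun b => (cnt g b (g p.1 p.2) : ℝ))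
        (fun _ _ => Nat.cast_nonneg _) (mem_univ p.1))
    rw [Real.logb_div hM.ne' h1.ne', Real.logb_div hM.ne' h2.ne', Real.logb_div h2.ne' h1.ne']
    ring
  rw [Finset.sum_congr rfl fun p _ => hterm p,
    sum_eq_sum_cnt g T hT fun b y => Real.logb 2 ((∑ b', (cnt g b' y : ℝ)) / cnt g b y)]
  refine Finset.sum_congr rfl fun y _ => ?_
  rw [sum_zmod_two, sum_zmod_two, pairEnt]

/-- `H(B | Y) ≥ 0` (the side information is a function of the pair). [folklore] -/
theorem condEntG_nonneg (g : ZMod 2 → Ω → β) : 0 ≤ condEntG g :=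
  sub_nonneg.2 (mapEntropy_comp_le univ (fun p : ZMod 2 × Ω => (p.1, g p.1 p.2)) Prod.snd)

/-! ### The Bhattacharyya parameter -/

/-- The Bhattacharyya sum may be taken over any finite set of outputs containing the image (the
summand vanishes elsewhere). [folklore] -/
theorem bhatta_eq_sum (g : ZMod 2 → Ω → β) (T : Finset β)
    (hT : univ.image (fun p : ZMod 2 × Ω => g p.1 p.2) ⊆ T) :
    bhatta g = (∑ y ∈ T, Real.sqrt (cnt g 0 y * cnt g 1 y)) / Fintype.card Ω := by
  unfold bhatta
  rw [Finset.sum_subset hT]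
  intro y _ hy
  rw [cnt_eq_zero_of_not_mem g 0 hy]
  simp

/-- `0 ≤ Z(B | Y)`. [folklore] -/
theorem bhatta_nonneg (g : ZMod 2 → Ω → β) : 0 ≤ bhatta g :=
  div_nonneg (Finset.sum_nonneg fun _ _ => Real.sqrt_nonneg _) (Nat.cast_nonneg _)

/-- AM–GM for a pair of counts: `√(ab) ≤ (a + b)/2`. [folklore] -/
theorem sqrt_mul_le_half_add {a b : ℝ} (ha : 0 ≤ a) (hb : 0 ≤ b) :
    Real.sqrt (a * b) ≤ (a + b) / 2 := by
  rw [Real.sqrt_le_iff]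
  exact ⟨by positivity, by nlinarith [sq_nonneg (a - b)]⟩

/-- `Z(B | Y) ≤ 1` (AM–GM termwise: `√(N₀ N₁) ≤ (N₀ + N₁)/2`, and the counts of each input bit add
up to `|Ω|`). [cite: Arikan2010, §II (0 ≤ Z(X|Y) ≤ 1)] -/
theorem bhatta_le_one (g : ZMod 2 → Ω → β) : bhatta g ≤ 1 := by
  rcases isEmpty_or_nonempty Ω with hΩ | hΩ
  · unfold bhatta
    simp
  have hM : (0 : ℝ) < Fintype.card Ω := by exact_mod_cast Fintype.card_pos
  unfold bhatta
  rw [div_le_one hM]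
  set T := univ.image (fun p : ZMod 2 × Ω => g p.1 p.2)
  calc ∑ y ∈ T, Real.sqrt (cnt g 0 y * cnt g 1 y)
      ≤ ∑ y ∈ T, ((cnt g 0 y : ℝ) + cnt g 1 y) / 2 :=
        Finset.sum_le_sum fun y _ => sqrt_mul_le_half_add (Nat.cast_nonneg _) (Nat.cast_nonneg _)
    _ = Fintype.card Ω := by
        rw [← Finset.sum_div, Finset.sum_add_distrib,
          sum_cnt_real g 0 T fun w => mem_image_out g 0 w,
          sum_cnt_real g 1 T fun w => mem_image_out g 1 w]
        ring

/-- `0 ≤ Z ≤ 1` for a packaged source. [cite: Arikan2010, §II (0 ≤ Z(X|Y) ≤ 1)] -/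
theorem Src.zParam_nonneg (S : Src) : 0 ≤ S.zParam :=
  bhatta_nonneg S.g

/-- `Z ≤ 1` for a packaged source. [cite: Arikan2010, §II (0 ≤ Z(X|Y) ≤ 1)] -/
theorem Src.zParam_le_one (S : Src) : S.zParam ≤ 1 :=
  bhatta_le_one S.g

/-- `0 ≤ H` for a packaged source. [folklore] -/
theorem Src.H_nonneg (S : Src) : 0 ≤ S.H :=
  condEntG_nonneg S.g

end Literature.InformationTheory.Coding.Polar

end
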